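import Mathlib
import Literature.NumberTheory.Transcendental.AssociatorsMainLemmaProofs
import HarnessLib

/-!
# Associators VIII: the linearization principle [BarnatanDancso2011, §3]

Seventh proofs file towards [Furusho2010, Thm 1] (`furusho_pentagon_hexagon`). Bar-Natan–Dancso's
second tool:

> The "linearization principle" is the standard fact that the pentagon `P(Φ) = 1` and the
> hexagons `H±(Φ) = 1` can be "linearized". Precisely, ... if `Φ` and `Φ'` satisfy the pentagon
> equation modulo degree `m` ... and are equal modulo degree `m`, i.e. `φ := (Φ - Φ')^{(m)}` is
> homogeneous of degree `m`, then `P(Φ) - P(Φ') = dP(φ)` modulo degree `(m+1)`. Likewise for the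
> hexagons ... Note that if `Φ` and `Φ'` are group-like, then `φ` is primitive.

In the tree's conventions "modulo degree `m + 1`" is "in the weight truncation `U𝔞₄/(deg > m)`",
i.e. level `N = m` of `NCSeries.DrinfeldPentagon` / `NCSeries.DrinfeldHexagon`. Contents:

1. the weight filtration `DrinfeldKohnoTrunc.wFil n` of `U𝔞 ⊗ R/(deg > N)` (span of products of
   `≥ n` weight-one elements): multiplicative, `wFil n = 0` for `n > N`, the absorption rules
   `u · y = y = y · u` for `u ∈ 1 + wFil 1`, `y ∈ wFil N`, inverses of elements of `1 + wFil 1`;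
2. `NCSeries.degPart m φ` (the homogeneous part of degree `m`) and
   `NCSeries.isPrimitive_degPart_sub`: the degree-`m` part of the difference of two group-like
   series agreeing below degree `m` is primitive;
3. **pentagon linearization** `NCSeries.dP_sub_eq_zero_of_pentagon`: if `Φ, Φ'` have constant
   term `1`, agree below degree `N`, and both satisfy the pentagon at level `N`, then
   `dP_N(Φ' - Φ) = 0` (`= dP_N((Φ' - Φ)_N)`);
4. **hexagon linearization** `NCSeries.hexagon_rhs_eq_of_agree` (and `B`): under the same
   agreement hypotheses the right-hand sides of the level-`N` hexagons for `Φ'` and `Φ` differ by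
   the linearized hexagon of the difference.

No named facts are introduced.

## References

* D. Bar-Natan, Z. Dancso, *Pentagon and hexagon equations following Furusho*, Proc. AMS 140
  (2012), 1243–1250, §3. [BarnatanDancso2011]
* H. Furusho, *Pentagon and hexagon equations*, Ann. of Math. 171 (2010), §2, proof of Lemma 9
  ("(10) for φ₂ yields (7) for ψ⁽ⁿ⁾"). [Furusho2010]
-/

noncomputable section

open scoped BigOperators

namespace Literature.NumberTheory.Transcendental

universe u v

/-! ## 1. The weight filtration of the truncated Drinfeld–Kohno algebra -/

namespace DrinfeldKohnoTrunc

variable {R : Type u} [CommRing R] {ι : Type v} {N : ℕ}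

/-- The generating set of `wFil n`: products of lists of `≥ n` weight-one elements. [folklore] -/
def wFilGens (n : ℕ) : Set (DrinfeldKohnoTrunc R ι N) :=
  {x | ∃ L : List (DrinfeldKohnoTrunc R ι N),
    (∀ y ∈ L, y ∈ (genSpan : Submodule R (DrinfeldKohnoTrunc R ι N))) ∧ n ≤ L.length ∧ L.prod = x}

/-- **The weight filtration** `wFil n` of `U𝔞 ⊗ R/(deg > N)`: the span of the products of at
least `n` weight-one elements (elements of the span of the generators). [folklore] -/
def wFil (n : ℕ) : Submodule R (DrinfeldKohnoTrunc R ι N) := Submodule.span R (wFilGens n)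

/-- A product of `≥ n` weight-one elements lies in `wFil n`. [folklore] -/
theorem list_prod_mem_wFil {n : ℕ} (L : List (DrinfeldKohnoTrunc R ι N))
    (hL : ∀ y ∈ L, y ∈ (genSpan : Submodule R (DrinfeldKohnoTrunc R ι N))) (hn : n ≤ L.length) :
    L.prod ∈ (wFil n : Submodule R (DrinfeldKohnoTrunc R ι N)) :=
  Submodule.subset_span ⟨L, hL, hn, rfl⟩

/-- Weight-one elements lie in `wFil 1`. [folklore] -/
theorem mem_wFil_one_of_mem_genSpan {x : DrinfeldKohnoTrunc R ι N}
    (hx : x ∈ (genSpan : Submodule R (DrinfeldKohnoTrunc R ι N))) :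
    x ∈ (wFil 1 : Submodule R (DrinfeldKohnoTrunc R ι N)) := by
  have h := list_prod_mem_wFil (n := 1) [x] (by simpa using hx) (by simp)
  rwa [List.prod_singleton] at h

/-- The filtration is antitone. [folklore] -/
theorem wFil_antitone {m n : ℕ} (h : m ≤ n) :
    (wFil n : Submodule R (DrinfeldKohnoTrunc R ι N)) ≤ wFil m :=
  Submodule.span_mono fun _ ⟨L, hL, hn, hx⟩ => ⟨L, hL, le_trans h hn, hx⟩

/-- The filtration is multiplicative: `wFil a · wFil b ⊆ wFil (a + b)`. [folklore] -/
theorem wFil_mul_le (a b : ℕ) :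
    (wFil a : Submodule R (DrinfeldKohnoTrunc R ι N)) * wFil b ≤ wFil (a + b) := by
  rw [wFil, wFil, Submodule.span_mul_span, Submodule.span_le]
  rintro _ ⟨x, ⟨L₁, hL₁, ha, rfl⟩, y, ⟨L₂, hL₂, hb, rfl⟩, rfl⟩
  refine Submodule.subset_span ⟨L₁ ++ L₂, fun z hz => ?_, by simp; omega, by rw [List.prod_append]⟩
  rw [List.mem_append] at hz
  rcases hz with hz | hz
  · exact hL₁ z hz
  · exact hL₂ z hz

/-- Products land in the expected step of the filtration. [folklore] -/
theorem mul_mem_wFil {a b : ℕ} {x y : DrinfeldKohnoTrunc R ι N}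
    (hx : x ∈ (wFil a : Submodule R (DrinfeldKohnoTrunc R ι N)))
    (hy : y ∈ (wFil b : Submodule R (DrinfeldKohnoTrunc R ι N))) :
    x * y ∈ (wFil (a + b) : Submodule R (DrinfeldKohnoTrunc R ι N)) :=
  wFil_mul_le a b (Submodule.mul_mem_mul hx hy)

/-- Powers of elements of `wFil 1`. [folklore] -/
theorem pow_mem_wFil {x : DrinfeldKohnoTrunc R ι N}
    (hx : x ∈ (wFil 1 : Submodule R (DrinfeldKohnoTrunc R ι N))) :
    ∀ i : ℕ, 1 ≤ i → x ^ i ∈ (wFil i : Submodule R (DrinfeldKohnoTrunc R ι N))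
  | 0, h => absurd h (by omega)
  | 1, _ => by rwa [pow_one]
  | i + 2, _ => by
    rw [pow_succ]
    have h := mul_mem_wFil (pow_mem_wFil hx (i + 1) (by omega)) hx
    exact h

/-- The filtration dies above the truncation level. [folklore] -/
theorem wFil_eq_bot {n : ℕ} (h : N < n) : (wFil n : Submodule R (DrinfeldKohnoTrunc R ι N)) = ⊥ := by
  rw [wFil, Submodule.span_eq_bot]
  rintro _ ⟨L, hL, hn, rfl⟩
  exact list_prod_eq_zero_of_mem_genSpan L hL (by omega)

/-- Elements of `wFil n`, `n > N`, vanish. [folklore] -/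
theorem eq_zero_of_mem_wFil {n : ℕ} (h : N < n) {x : DrinfeldKohnoTrunc R ι N}
    (hx : x ∈ (wFil n : Submodule R (DrinfeldKohnoTrunc R ι N))) : x = 0 := by
  rwa [wFil_eq_bot h, Submodule.mem_bot] at hx

/-- **Absorption on the left**: `u y = y` for `u ∈ 1 + wFil 1`, `y ∈ wFil n`, `n ≥ N`. [folklore] -/
theorem mul_eq_right_of_wFil {n : ℕ} (hn : N ≤ n) {u y : DrinfeldKohnoTrunc R ι N}
    (hu : u - 1 ∈ (wFil 1 : Submodule R (DrinfeldKohnoTrunc R ι N)))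
    (hy : y ∈ (wFil n : Submodule R (DrinfeldKohnoTrunc R ι N))) : u * y = y := by
  have h := eq_zero_of_mem_wFil (show N < 1 + n by omega) (mul_mem_wFil hu hy)
  rwa [sub_mul, one_mul, sub_eq_zero] at h

/-- **Absorption on the right**: `y u = y` for `u ∈ 1 + wFil 1`, `y ∈ wFil n`, `n ≥ N`. [folklore] -/
theorem mul_eq_left_of_wFil {n : ℕ} (hn : N ≤ n) {u y : DrinfeldKohnoTrunc R ι N}
    (hu : u - 1 ∈ (wFil 1 : Submodule R (DrinfeldKohnoTrunc R ι N)))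
    (hy : y ∈ (wFil n : Submodule R (DrinfeldKohnoTrunc R ι N))) : y * u = y := by
  have h := eq_zero_of_mem_wFil (show N < n + 1 by omega) (mul_mem_wFil hy hu)
  rwa [mul_sub, mul_one, sub_eq_zero] at h

/-- Products of two elements of `wFil N` vanish (`N ≥ 1`). [folklore] -/
theorem mul_eq_zero_of_wFil {m n : ℕ} (h : N < m + n) {x y : DrinfeldKohnoTrunc R ι N}
    (hx : x ∈ (wFil m : Submodule R (DrinfeldKohnoTrunc R ι N)))
    (hy : y ∈ (wFil n : Submodule R (DrinfeldKohnoTrunc R ι N))) : x * y = 0 :=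
  eq_zero_of_mem_wFil h (mul_mem_wFil hx hy)

/-- `1 + wFil 1` is closed under products. [folklore] -/
theorem mul_sub_one_mem_wFil {u u' : DrinfeldKohnoTrunc R ι N}
    (hu : u - 1 ∈ (wFil 1 : Submodule R (DrinfeldKohnoTrunc R ι N)))
    (hu' : u' - 1 ∈ (wFil 1 : Submodule R (DrinfeldKohnoTrunc R ι N))) :
    u * u' - 1 ∈ (wFil 1 : Submodule R (DrinfeldKohnoTrunc R ι N)) := by
  have e : u * u' - 1 = (u - 1) * (u' - 1) + (u - 1) + (u' - 1) := by noncomm_ring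
  rw [e]
  exact Submodule.add_mem _ (Submodule.add_mem _ (wFil_antitone (by omega) (mul_mem_wFil hu hu')) hu) hu'

/-- **Inverses in `1 + wFil 1`**: `u` has the two-sided inverse `Σ_{i ≤ N} (1 - u)^i`, so
`Ring.inverse u - 1 ∈ wFil 1`. [folklore] -/
theorem ring_inverse_of_sub_one_mem_wFil {u : DrinfeldKohnoTrunc R ι N}
    (hu : u - 1 ∈ (wFil 1 : Submodule R (DrinfeldKohnoTrunc R ι N))) :
    u * Ring.inverse u = 1 ∧ Ring.inverse u * u = 1 ∧
      Ring.inverse u - 1 ∈ (wFil 1 : Submodule R (DrinfeldKohnoTrunc R ι N)) := by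
  have ha : 1 - u ∈ (wFil 1 : Submodule R (DrinfeldKohnoTrunc R ι N)) := by
    rw [show (1 - u : DrinfeldKohnoTrunc R ι N) = -(u - 1) by abel]
    exact Submodule.neg_mem _ hu
  have hnil : (1 - u) ^ (N + 1) = 0 :=
    eq_zero_of_mem_wFil (Nat.lt_succ_self N) (pow_mem_wFil ha (N + 1) (by omega))
  have hus : u * ∑ i ∈ Finset.range (N + 1), (1 - u) ^ i = 1 := by
    have h := mul_neg_geom_sum (1 - u) (N + 1)
    rwa [sub_sub_cancel, hnil, sub_zero] at h
  have hsu : (∑ i ∈ Finset.range (N + 1), (1 - u) ^ i) * u = 1 := by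
    have h := geom_sum_mul_neg (1 - u) (N + 1)
    rwa [sub_sub_cancel, hnil, sub_zero] at h
  have hinv : Ring.inverse u = ∑ i ∈ Finset.range (N + 1), (1 - u) ^ i :=
    NCSeries.ring_inverse_eq_of_mul_eq_one hus hsu
  refine ⟨by rw [hinv, hus], by rw [hinv, hsu], ?_⟩
  rw [hinv, Finset.sum_range_succ', pow_zero, add_sub_cancel_right]
  exact Submodule.sum_mem _ fun i _ => wFil_antitone (by omega) (pow_mem_wFil ha (i + 1) (by omega))

/-- Truncated exponentials of weight-one elements lie in `1 + wFil 1`. [folklore] -/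
theorem truncExp_sub_one_mem_wFil [Algebra ℚ R] {x : DrinfeldKohnoTrunc R ι N}
    (hx : x ∈ (genSpan : Submodule R (DrinfeldKohnoTrunc R ι N))) :
    truncExp R N x - 1 ∈ (wFil 1 : Submodule R (DrinfeldKohnoTrunc R ι N)) := by
  rw [truncExp, Finset.sum_range_succ', pow_zero, Nat.factorial_zero, Nat.cast_one, div_one, map_one,
    one_smul, add_sub_cancel_right]
  exact Submodule.sum_mem _ fun i _ => Submodule.smul_mem _ _
    (wFil_antitone (by omega) (pow_mem_wFil (mem_wFil_one_of_mem_genSpan hx) (i + 1) (by omega)))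

end DrinfeldKohnoTrunc

namespace NCSeries

/-! ## 2. Evaluations and the filtration -/

section EvalFil

variable {k : Type u} [CommRing k] {ι : Type v} {N : ℕ}

/-- A series vanishing below degree `n`, evaluated at weight-one arguments, lies in `wFil n`.
[folklore] -/
theorem evalTrunc_mem_wFil {n : ℕ} {φ : NCSeries Bool k} (hφ : ∀ w : List Bool, w.length < n → φ w = 0)
    (v : Bool → DrinfeldKohnoTrunc k ι N)
    (hv : ∀ b, v b ∈ (DrinfeldKohnoTrunc.genSpan : Submodule k (DrinfeldKohnoTrunc k ι N))) :
    evalTrunc N v φ ∈ (DrinfeldKohnoTrunc.wFil n : Submodule k (DrinfeldKohnoTrunc k ι N)) := by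
  rw [evalTrunc_eq_sum_wordsLE]
  refine Submodule.sum_mem _ fun w _ => ?_
  by_cases hw : w.length < n
  · rw [hφ w hw, zero_smul]; exact Submodule.zero_mem _
  · exact Submodule.smul_mem _ _ (DrinfeldKohnoTrunc.list_prod_mem_wFil _
      (fun y hy => by obtain ⟨b, -, rfl⟩ := List.mem_map.mp hy; exact hv b) (by simp; omega))

/-- A series with constant term `1`, evaluated at weight-one arguments, lies in `1 + wFil 1`.
[folklore] -/
theorem evalTrunc_sub_one_mem_wFil {φ : NCSeries Bool k} (hφ : φ [] = 1)
    (v : Bool → DrinfeldKohnoTrunc k ι N)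
    (hv : ∀ b, v b ∈ (DrinfeldKohnoTrunc.genSpan : Submodule k (DrinfeldKohnoTrunc k ι N))) :
    evalTrunc N v φ - 1 ∈ (DrinfeldKohnoTrunc.wFil 1 : Submodule k (DrinfeldKohnoTrunc k ι N)) := by
  have e : evalTrunc N v φ - 1 = evalTrunc N v (φ - 1) := by
    have h := evalTrunc_add N v (φ - 1) 1
    rw [sub_add_cancel, evalTrunc_one] at h
    rw [h, add_sub_cancel_right]
  rw [e]
  refine evalTrunc_mem_wFil (fun w hw => ?_) v hv
  rw [Nat.lt_one_iff, List.length_eq_zero_iff] at hw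
  subst hw
  rw [sub_apply, hφ, one_apply_nil, sub_self]

end EvalFil

/-! ## 3. Homogeneous parts; primitivity of the first difference of group-like series -/

section DegPart

variable {α : Type u} {R : Type v}

/-- The homogeneous part of degree `m` of a series. [folklore] -/
def degPart [Zero R] (m : ℕ) (φ : NCSeries α R) : NCSeries α R :=
  fun w => if w.length = m then φ w else 0

/-- Coefficients of the degree-`m` part. [folklore] -/
@[simp] theorem degPart_apply [Zero R] (m : ℕ) (φ : NCSeries α R) (w : List α) :
    degPart m φ w = if w.length = m then φ w else 0 := rfl

/-- **The first difference of two group-like series is primitive** [BarnatanDancso2011, §3,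
"Note that if `Φ` and `Φ'` are group-like, then `φ` is primitive"]: if `Φ, Φ'` are group-like and
agree below degree `m`, the degree-`m` part of `Φ' - Φ` is primitive.
[cite: BarnatanDancso2011, §3] -/
theorem isPrimitive_degPart_sub [Ring R] {Φ Φ' : NCSeries α R} (hΦ : IsGroupLike Φ)
    (hΦ' : IsGroupLike Φ') {m : ℕ} (hagree : ∀ w : List α, w.length < m → Φ w = Φ' w) :
    IsPrimitive (degPart m (Φ' - Φ)) := by
  refine ⟨?_, fun u v hu hv => ?_⟩
  · rw [degPart_apply]
    split_ifs
    · rw [sub_apply, hΦ.1, hΦ'.1, sub_self]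
    · rfl
  by_cases hm : u.length + v.length = m
  · have hmap : (MZV.shuffleWord u v).map (degPart m (Φ' - Φ)) =
        (MZV.shuffleWord u v).map (fun w => Φ' w + ((-1 : R) • Φ) w) := by
      refine List.map_congr_left fun w hw => ?_
      rw [degPart_apply, if_pos (by rw [MZV.length_of_mem_shuffleWord u v hw, hm]), sub_apply,
        smul_apply, smul_eq_mul, neg_one_mul, sub_eq_add_neg]
    rw [hmap, List.sum_map_add]
    have h1 := hΦ'.2 u v
    have h2 := hΦ.2 u v
    have hs : ((MZV.shuffleWord u v).map ((-1 : R) • Φ)).sum = (-1 : R) • ((MZV.shuffleWord u v).map Φ).sum := by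
      rw [List.smul_sum, List.map_map]; rfl
    rw [show ((MZV.shuffleWord u v).map fun w => ((-1 : R) • Φ) w) =
      (MZV.shuffleWord u v).map ((-1 : R) • Φ) from rfl, hs, ← h1, ← h2]
    have hul : u.length < m := by
      have := List.length_pos_of_ne_nil hv; omega
    have hvl : v.length < m := by
      have := List.length_pos_of_ne_nil hu; omega
    rw [← hagree u hul, ← hagree v hvl, smul_eq_mul, neg_one_mul, add_neg_cancel]
  · refine List.sum_eq_zero fun x hx => ?_
    obtain ⟨w, hw, rfl⟩ := List.mem_map.mp hx
    rw [degPart_apply, if_neg]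
    rw [MZV.length_of_mem_shuffleWord u v hw]
    exact hm

/-- The degree-`m` part has no terms of degree `≠ m`; in particular none of degree `≤ 2` if
`m ≥ 3`. [folklore] -/
theorem degPart_apply_of_ne [Zero R] {m : ℕ} (φ : NCSeries α R) {w : List α} (hw : w.length ≠ m) :
    degPart m φ w = 0 := if_neg hw

/-- Below and at degree `m`, the degree-`m` part of `Φ' - Φ` agrees with `Φ' - Φ` when `Φ, Φ'`
agree below degree `m`. [folklore] -/
theorem degPart_sub_apply_of_le [Ring R] {Φ Φ' : NCSeries α R} {m : ℕ}
    (hagree : ∀ w : List α, w.length < m → Φ w = Φ' w) {w : List α} (hw : w.length ≤ m) :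
    degPart m (Φ' - Φ) w = (Φ' - Φ) w := by
  rw [degPart_apply]
  split_ifs with h
  · rfl
  · rw [sub_apply, hagree w (by omega), sub_self]

end DegPart

/-! ## 4. Linearization of the pentagon -/

section LinPentagon

variable {k : Type u} [CommRing k] {N : ℕ}

local notation "𝔱" => (DrinfeldKohnoTrunc.t k N : Fin 4 → Fin 4 → DrinfeldKohnoTrunc k (Fin 4) N)

/-- The linearized pentagon only sees coefficients of weight `≤ N`. [folklore] -/
theorem dP_congr {φ ψ : NCSeries Bool k} (h : ∀ w : List Bool, w.length ≤ N → φ w = ψ w) :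
    dP k N φ = dP k N ψ := by
  simp only [dP, subst₂, evalTrunc_congr N _ h]

/-- The linearized hexagon only sees coefficients of weight `≤ N`. [folklore] -/
theorem dH_congr {φ ψ : NCSeries Bool k} (h : ∀ w : List Bool, w.length ≤ N → φ w = ψ w) :
    dH k N φ = dH k N ψ := by
  simp only [dH, subst₂, evalTrunc_congr N _ h]

/-- Sums of two generators are weight-one. [folklore] -/
theorem add_t_mem_genSpan (i j i' j' : Fin 4) :
    𝔱 i j + 𝔱 i' j' ∈ (DrinfeldKohnoTrunc.genSpan : Submodule k (DrinfeldKohnoTrunc k (Fin 4) N)) :=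
  Submodule.add_mem _ (DrinfeldKohnoTrunc.t_mem_genSpan i j) (DrinfeldKohnoTrunc.t_mem_genSpan i' j')

/-- **Linearization of the pentagon** [BarnatanDancso2011, §3]: if `Φ, Φ'` have constant term
`1`, agree below degree `N`, and both satisfy Drinfeld's pentagon in `U𝔞₄ ⊗ k/(deg > N)`, then
`dP_N(Φ' - Φ) = 0` — "`P(Φ) - P(Φ') = dP(φ)` modulo degree `m + 1`". In `U𝔞₄/(deg > N)` the
evaluations of `φ = Φ' - Φ` lie in `wFil N`, those of `Φ` in `1 + wFil 1`, so all cross terms of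
the expanded pentagon for `Φ' = Φ + φ` collapse (`wFil 1 · wFil N = 0 = wFil N · wFil N`).
[cite: BarnatanDancso2011, §3] -/
theorem dP_sub_eq_zero_of_pentagon {Φ Φ' : NCSeries Bool k} (hΦ : Φ [] = 1) (hΦ' : Φ' [] = 1)
    (hagree : ∀ w : List Bool, w.length < N → Φ w = Φ' w)
    (hP : subst₂ N Φ (t₄ k N 0 1) (t₄ k N 1 2 + t₄ k N 1 3) *
        subst₂ N Φ (t₄ k N 0 2 + t₄ k N 1 2) (t₄ k N 2 3) =
      subst₂ N Φ (t₄ k N 1 2) (t₄ k N 2 3) *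
          subst₂ N Φ (t₄ k N 0 1 + t₄ k N 0 2) (t₄ k N 1 3 + t₄ k N 2 3) *
        subst₂ N Φ (t₄ k N 0 1) (t₄ k N 1 2))
    (hP' : subst₂ N Φ' (t₄ k N 0 1) (t₄ k N 1 2 + t₄ k N 1 3) *
        subst₂ N Φ' (t₄ k N 0 2 + t₄ k N 1 2) (t₄ k N 2 3) =
      subst₂ N Φ' (t₄ k N 1 2) (t₄ k N 2 3) *
          subst₂ N Φ' (t₄ k N 0 1 + t₄ k N 0 2) (t₄ k N 1 3 + t₄ k N 2 3) *
        subst₂ N Φ' (t₄ k N 0 1) (t₄ k N 1 2)) :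
    dP k N (Φ' - Φ) = 0 := by
  set φ := Φ' - Φ with hφdef
  have hφ : ∀ w : List Bool, w.length < max N 1 → φ w = 0 := fun w hw => by
    rcases Nat.lt_or_ge w.length N with h | h
    · rw [hφdef, sub_apply, hagree w h, sub_self]
    · have h0 : w = [] := List.length_eq_zero_iff.mp (by omega)
      subst h0
      rw [hφdef, sub_apply, hΦ, hΦ', sub_self]
  have hΦ'eq : Φ' = Φ + φ := by rw [hφdef]; abel
  -- the five argument pairs are weight-one
  have g1 : ∀ b, bsub (𝔱 0 1) (𝔱 1 2 + 𝔱 1 3) b ∈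
      (DrinfeldKohnoTrunc.genSpan : Submodule k (DrinfeldKohnoTrunc k (Fin 4) N)) := fun b => by
    cases b
    · exact DrinfeldKohnoTrunc.t_mem_genSpan 0 1
    · exact add_t_mem_genSpan 1 2 1 3
  have g2 : ∀ b, bsub (𝔱 0 2 + 𝔱 1 2) (𝔱 2 3) b ∈
      (DrinfeldKohnoTrunc.genSpan : Submodule k (DrinfeldKohnoTrunc k (Fin 4) N)) := fun b => by
    cases b
    · exact add_t_mem_genSpan 0 2 1 2
    · exact DrinfeldKohnoTrunc.t_mem_genSpan 2 3
  have g3 : ∀ b, bsub (𝔱 1 2) (𝔱 2 3) b ∈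
      (DrinfeldKohnoTrunc.genSpan : Submodule k (DrinfeldKohnoTrunc k (Fin 4) N)) := fun b => by
    cases b
    · exact DrinfeldKohnoTrunc.t_mem_genSpan 1 2
    · exact DrinfeldKohnoTrunc.t_mem_genSpan 2 3
  have g4 : ∀ b, bsub (𝔱 0 1 + 𝔱 0 2) (𝔱 1 3 + 𝔱 2 3) b ∈
      (DrinfeldKohnoTrunc.genSpan : Submodule k (DrinfeldKohnoTrunc k (Fin 4) N)) := fun b => by
    cases b
    · exact add_t_mem_genSpan 0 1 0 2
    · exact add_t_mem_genSpan 1 3 2 3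
  have g5 : ∀ b, bsub (𝔱 0 1) (𝔱 1 2) b ∈
      (DrinfeldKohnoTrunc.genSpan : Submodule k (DrinfeldKohnoTrunc k (Fin 4) N)) := fun b => by
    cases b
    · exact DrinfeldKohnoTrunc.t_mem_genSpan 0 1
    · exact DrinfeldKohnoTrunc.t_mem_genSpan 1 2
  -- memberships: `Φ`-factors in `1 + wFil 1`, `φ`-factors in `wFil (max N 1)`
  have u1 := evalTrunc_sub_one_mem_wFil hΦ _ g1
  have u2 := evalTrunc_sub_one_mem_wFil hΦ _ g2
  have u3 := evalTrunc_sub_one_mem_wFil hΦ _ g3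
  have u4 := evalTrunc_sub_one_mem_wFil hΦ _ g4
  have u5 := evalTrunc_sub_one_mem_wFil hΦ _ g5
  have y1 := evalTrunc_mem_wFil hφ _ g1
  have y2 := evalTrunc_mem_wFil hφ _ g2
  have y3 := evalTrunc_mem_wFil hφ _ g3
  have y4 := evalTrunc_mem_wFil hφ _ g4
  have y5 := evalTrunc_mem_wFil hφ _ g5
  have u34 := DrinfeldKohnoTrunc.mul_sub_one_mem_wFil u3 u4
  have hle : N ≤ max N 1 := le_max_left N 1
  have hlt : N < max N 1 + max N 1 := by omega
  -- absorptions and vanishings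
  have a12 := DrinfeldKohnoTrunc.mul_eq_right_of_wFil hle u1 y2
  have a21 := DrinfeldKohnoTrunc.mul_eq_left_of_wFil hle u2 y1
  have z12 := DrinfeldKohnoTrunc.mul_eq_zero_of_wFil hlt y1 y2
  have a34 := DrinfeldKohnoTrunc.mul_eq_right_of_wFil hle u3 y4
  have a43 := DrinfeldKohnoTrunc.mul_eq_left_of_wFil hle u4 y3
  have z34 := DrinfeldKohnoTrunc.mul_eq_zero_of_wFil hlt y3 y4
  have a345 := DrinfeldKohnoTrunc.mul_eq_right_of_wFil hle u34 y5
  have a45 := DrinfeldKohnoTrunc.mul_eq_left_of_wFil hle u5 y4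
  have z45 := DrinfeldKohnoTrunc.mul_eq_zero_of_wFil hlt y4 y5
  have a35 := DrinfeldKohnoTrunc.mul_eq_left_of_wFil hle u5 y3
  have z35 := DrinfeldKohnoTrunc.mul_eq_zero_of_wFil hlt y3 y5
  -- expand both sides of the pentagon for `Φ' = Φ + φ`
  have expandL : (evalTrunc N (bsub (𝔱 0 1) (𝔱 1 2 + 𝔱 1 3)) Φ + evalTrunc N (bsub (𝔱 0 1) (𝔱 1 2 + 𝔱 1 3)) φ) *
      (evalTrunc N (bsub (𝔱 0 2 + 𝔱 1 2) (𝔱 2 3)) Φ + evalTrunc N (bsub (𝔱 0 2 + 𝔱 1 2) (𝔱 2 3)) φ) =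
      evalTrunc N (bsub (𝔱 0 1) (𝔱 1 2 + 𝔱 1 3)) Φ * evalTrunc N (bsub (𝔱 0 2 + 𝔱 1 2) (𝔱 2 3)) Φ +
        (evalTrunc N (bsub (𝔱 0 1) (𝔱 1 2 + 𝔱 1 3)) φ + evalTrunc N (bsub (𝔱 0 2 + 𝔱 1 2) (𝔱 2 3)) φ) := by
    rw [add_mul, mul_add, mul_add, a12, a21, z12]; abel
  have expandR : (evalTrunc N (bsub (𝔱 1 2) (𝔱 2 3)) Φ + evalTrunc N (bsub (𝔱 1 2) (𝔱 2 3)) φ) *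
      (evalTrunc N (bsub (𝔱 0 1 + 𝔱 0 2) (𝔱 1 3 + 𝔱 2 3)) Φ +
        evalTrunc N (bsub (𝔱 0 1 + 𝔱 0 2) (𝔱 1 3 + 𝔱 2 3)) φ) *
      (evalTrunc N (bsub (𝔱 0 1) (𝔱 1 2)) Φ + evalTrunc N (bsub (𝔱 0 1) (𝔱 1 2)) φ) =
      evalTrunc N (bsub (𝔱 1 2) (𝔱 2 3)) Φ * evalTrunc N (bsub (𝔱 0 1 + 𝔱 0 2) (𝔱 1 3 + 𝔱 2 3)) Φ *
          evalTrunc N (bsub (𝔱 0 1) (𝔱 1 2)) Φ +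
        (evalTrunc N (bsub (𝔱 1 2) (𝔱 2 3)) φ + evalTrunc N (bsub (𝔱 0 1 + 𝔱 0 2) (𝔱 1 3 + 𝔱 2 3)) φ +
          evalTrunc N (bsub (𝔱 0 1) (𝔱 1 2)) φ) := by
    simp only [add_mul, mul_add, a34, a43, z34, a345, a45, z45, a35, z35, add_zero]
    abel
  dsimp only [subst₂, t₄] at hP hP'
  rw [hΦ'eq] at hP'
  simp only [evalTrunc_add] at hP'
  rw [expandL, expandR, hP] at hP'
  have e := add_left_cancel hP'
  unfold dP
  dsimp only [subst₂, t₄]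
  rw [show -evalTrunc N (bsub (𝔱 0 1) (𝔱 1 2 + 𝔱 1 3)) φ - evalTrunc N (bsub (𝔱 0 2 + 𝔱 1 2) (𝔱 2 3)) φ +
      evalTrunc N (bsub (𝔱 1 2) (𝔱 2 3)) φ + evalTrunc N (bsub (𝔱 0 1 + 𝔱 0 2) (𝔱 1 3 + 𝔱 2 3)) φ +
      evalTrunc N (bsub (𝔱 0 1) (𝔱 1 2)) φ =
    (evalTrunc N (bsub (𝔱 1 2) (𝔱 2 3)) φ + evalTrunc N (bsub (𝔱 0 1 + 𝔱 0 2) (𝔱 1 3 + 𝔱 2 3)) φ +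
      evalTrunc N (bsub (𝔱 0 1) (𝔱 1 2)) φ) -
    (evalTrunc N (bsub (𝔱 0 1) (𝔱 1 2 + 𝔱 1 3)) φ + evalTrunc N (bsub (𝔱 0 2 + 𝔱 1 2) (𝔱 2 3)) φ) by abel,
    ← e, sub_self]

/-- The linearized pentagon of the first difference, in terms of its degree-`N` part.
[cite: BarnatanDancso2011, §3] -/
theorem dP_degPart_sub_eq_zero_of_pentagon {Φ Φ' : NCSeries Bool k} (hΦ : Φ [] = 1) (hΦ' : Φ' [] = 1)
    (hagree : ∀ w : List Bool, w.length < N → Φ w = Φ' w)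
    (hP : subst₂ N Φ (t₄ k N 0 1) (t₄ k N 1 2 + t₄ k N 1 3) *
        subst₂ N Φ (t₄ k N 0 2 + t₄ k N 1 2) (t₄ k N 2 3) =
      subst₂ N Φ (t₄ k N 1 2) (t₄ k N 2 3) *
          subst₂ N Φ (t₄ k N 0 1 + t₄ k N 0 2) (t₄ k N 1 3 + t₄ k N 2 3) *
        subst₂ N Φ (t₄ k N 0 1) (t₄ k N 1 2))
    (hP' : subst₂ N Φ' (t₄ k N 0 1) (t₄ k N 1 2 + t₄ k N 1 3) *
        subst₂ N Φ' (t₄ k N 0 2 + t₄ k N 1 2) (t₄ k N 2 3) =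
      subst₂ N Φ' (t₄ k N 1 2) (t₄ k N 2 3) *
          subst₂ N Φ' (t₄ k N 0 1 + t₄ k N 0 2) (t₄ k N 1 3 + t₄ k N 2 3) *
        subst₂ N Φ' (t₄ k N 0 1) (t₄ k N 1 2)) :
    dP k N (degPart N (Φ' - Φ)) = 0 := by
  rw [dP_congr (fun w hw => degPart_sub_apply_of_le hagree hw)]
  exact dP_sub_eq_zero_of_pentagon hΦ hΦ' hagree hP hP'

end LinPentagon

/-! ## 5. Linearization of the hexagons -/

section LinHexagon

variable {k : Type u} [CommRing k] [Algebra ℚ k] {N : ℕ}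

local notation "𝔱" => (DrinfeldKohnoTrunc.t k N : Fin 4 → Fin 4 → DrinfeldKohnoTrunc k (Fin 4) N)

omit [Algebra ℚ k] in
/-- **Inverting a perturbed unit**: for `u ∈ 1 + wFil 1` and `y ∈ wFil n`, `n ≥ N`,
`(u + y)⁻¹ = u⁻¹ - y` in `U𝔞/(deg > N)`. [folklore] -/
theorem ring_inverse_add_of_wFil {n : ℕ} (hn : N ≤ n) (hn1 : N < n + n)
    {u y : DrinfeldKohnoTrunc k (Fin 4) N}
    (hu : u - 1 ∈ (DrinfeldKohnoTrunc.wFil 1 : Submodule k (DrinfeldKohnoTrunc k (Fin 4) N)))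
    (hy : y ∈ (DrinfeldKohnoTrunc.wFil n : Submodule k (DrinfeldKohnoTrunc k (Fin 4) N))) :
    Ring.inverse (u + y) = Ring.inverse u - y := by
  obtain ⟨h1, h2, hinv⟩ := DrinfeldKohnoTrunc.ring_inverse_of_sub_one_mem_wFil hu
  refine ring_inverse_eq_of_mul_eq_one ?_ ?_
  · rw [add_mul, mul_sub, mul_sub, h1, DrinfeldKohnoTrunc.mul_eq_right_of_wFil hn hu hy,
      DrinfeldKohnoTrunc.mul_eq_left_of_wFil hn hinv hy, DrinfeldKohnoTrunc.mul_eq_zero_of_wFil hn1 hy hy]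
    abel
  · rw [sub_mul, mul_add, mul_add, h2, DrinfeldKohnoTrunc.mul_eq_right_of_wFil hn hinv hy,
      DrinfeldKohnoTrunc.mul_eq_left_of_wFil hn hu hy, DrinfeldKohnoTrunc.mul_eq_zero_of_wFil hn1 hy hy]
    abel

/-- **Linearization of the first hexagon** [BarnatanDancso2011, §3]: if `Φ, Φ'` have constant
term `1` and agree below degree `N`, the right-hand sides of the level-`N` hexagon
`NCSeries.DrinfeldHexagon` for `Φ'` and `Φ` differ exactly by the linearized hexagon
`dH_N(Φ' - Φ)` ("`H(Φ) - H(Φ') = dH(φ)` modulo degree `m + 1`").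
[cite: BarnatanDancso2011, §3] -/
theorem hexagon_rhs_eq_of_agree {Φ Φ' : NCSeries Bool k} (hΦ : Φ [] = 1) (hΦ' : Φ' [] = 1)
    (hagree : ∀ w : List Bool, w.length < N → Φ w = Φ' w) (μ : k) :
    subst₂ N Φ' (t₄ k N 0 2) (t₄ k N 0 1) *
            DrinfeldKohnoTrunc.expT (((1 / 2 : ℚ) • μ) • t₄ k N 0 2) *
          Ring.inverse (subst₂ N Φ' (t₄ k N 0 2) (t₄ k N 1 2)) *
        DrinfeldKohnoTrunc.expT (((1 / 2 : ℚ) • μ) • t₄ k N 1 2) *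
      subst₂ N Φ' (t₄ k N 0 1) (t₄ k N 1 2) =
    subst₂ N Φ (t₄ k N 0 2) (t₄ k N 0 1) *
            DrinfeldKohnoTrunc.expT (((1 / 2 : ℚ) • μ) • t₄ k N 0 2) *
          Ring.inverse (subst₂ N Φ (t₄ k N 0 2) (t₄ k N 1 2)) *
        DrinfeldKohnoTrunc.expT (((1 / 2 : ℚ) • μ) • t₄ k N 1 2) *
      subst₂ N Φ (t₄ k N 0 1) (t₄ k N 1 2) + dH k N (Φ' - Φ) := by
  set φ := Φ' - Φ with hφdef
  have hφ : ∀ w : List Bool, w.length < max N 1 → φ w = 0 := fun w hw => by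
    rcases Nat.lt_or_ge w.length N with h | h
    · rw [hφdef, sub_apply, hagree w h, sub_self]
    · have h0 : w = [] := List.length_eq_zero_iff.mp (by omega)
      subst h0
      rw [hφdef, sub_apply, hΦ, hΦ', sub_self]
  have hΦ'eq : Φ' = Φ + φ := by rw [hφdef]; abel
  have g1 : ∀ b, bsub (𝔱 0 2) (𝔱 0 1) b ∈
      (DrinfeldKohnoTrunc.genSpan : Submodule k (DrinfeldKohnoTrunc k (Fin 4) N)) := fun b => by
    cases b
    · exact DrinfeldKohnoTrunc.t_mem_genSpan 0 2
    · exact DrinfeldKohnoTrunc.t_mem_genSpan 0 1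
  have g2 : ∀ b, bsub (𝔱 0 2) (𝔱 1 2) b ∈
      (DrinfeldKohnoTrunc.genSpan : Submodule k (DrinfeldKohnoTrunc k (Fin 4) N)) := fun b => by
    cases b
    · exact DrinfeldKohnoTrunc.t_mem_genSpan 0 2
    · exact DrinfeldKohnoTrunc.t_mem_genSpan 1 2
  have g3 : ∀ b, bsub (𝔱 0 1) (𝔱 1 2) b ∈
      (DrinfeldKohnoTrunc.genSpan : Submodule k (DrinfeldKohnoTrunc k (Fin 4) N)) := fun b => by
    cases b
    · exact DrinfeldKohnoTrunc.t_mem_genSpan 0 1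
    · exact DrinfeldKohnoTrunc.t_mem_genSpan 1 2
  have u1 := evalTrunc_sub_one_mem_wFil hΦ _ g1
  have u2 := evalTrunc_sub_one_mem_wFil hΦ _ g2
  have u3 := evalTrunc_sub_one_mem_wFil hΦ _ g3
  have y1 := evalTrunc_mem_wFil hφ _ g1
  have y2 := evalTrunc_mem_wFil hφ _ g2
  have y3 := evalTrunc_mem_wFil hφ _ g3
  have he1 : DrinfeldKohnoTrunc.expT (((1 / 2 : ℚ) • μ) • 𝔱 0 2) - 1 ∈
      (DrinfeldKohnoTrunc.wFil 1 : Submodule k (DrinfeldKohnoTrunc k (Fin 4) N)) := by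
    rw [DrinfeldKohnoTrunc.expT_eq_truncExp]
    exact DrinfeldKohnoTrunc.truncExp_sub_one_mem_wFil
      (Submodule.smul_mem _ _ (DrinfeldKohnoTrunc.t_mem_genSpan 0 2))
  have he2 : DrinfeldKohnoTrunc.expT (((1 / 2 : ℚ) • μ) • 𝔱 1 2) - 1 ∈
      (DrinfeldKohnoTrunc.wFil 1 : Submodule k (DrinfeldKohnoTrunc k (Fin 4) N)) := by
    rw [DrinfeldKohnoTrunc.expT_eq_truncExp]
    exact DrinfeldKohnoTrunc.truncExp_sub_one_mem_wFil
      (Submodule.smul_mem _ _ (DrinfeldKohnoTrunc.t_mem_genSpan 1 2))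
  have hinv2 := (DrinfeldKohnoTrunc.ring_inverse_of_sub_one_mem_wFil u2).2.2
  have hle : N ≤ max N 1 := le_max_left N 1
  have hlt : N < max N 1 + max N 1 := by omega
  -- inverse of the perturbed middle factor
  have hinv : Ring.inverse (evalTrunc N (bsub (𝔱 0 2) (𝔱 1 2)) Φ + evalTrunc N (bsub (𝔱 0 2) (𝔱 1 2)) φ) =
      Ring.inverse (evalTrunc N (bsub (𝔱 0 2) (𝔱 1 2)) Φ) - evalTrunc N (bsub (𝔱 0 2) (𝔱 1 2)) φ :=
    ring_inverse_add_of_wFil hle hlt u2 y2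
  -- units built along the product
  have ue1 := DrinfeldKohnoTrunc.mul_sub_one_mem_wFil u1 he1
  have ue1i := DrinfeldKohnoTrunc.mul_sub_one_mem_wFil ue1 hinv2
  have ue1ie2 := DrinfeldKohnoTrunc.mul_sub_one_mem_wFil ue1i he2
  -- absorptions and vanishings
  have r1e1 := DrinfeldKohnoTrunc.mul_eq_left_of_wFil hle he1 y1
  have l2 := DrinfeldKohnoTrunc.mul_eq_right_of_wFil hle ue1 y2
  have r1i := DrinfeldKohnoTrunc.mul_eq_left_of_wFil hle hinv2 y1
  have z12 := DrinfeldKohnoTrunc.mul_eq_zero_of_wFil hlt y1 y2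
  have r2e2 := DrinfeldKohnoTrunc.mul_eq_left_of_wFil hle he2 y2
  have r1e2 := DrinfeldKohnoTrunc.mul_eq_left_of_wFil hle he2 y1
  have l3 := DrinfeldKohnoTrunc.mul_eq_right_of_wFil hle ue1ie2 y3
  have r2u3 := DrinfeldKohnoTrunc.mul_eq_left_of_wFil hle u3 y2
  have z23 := DrinfeldKohnoTrunc.mul_eq_zero_of_wFil hlt y2 y3
  have r1u3 := DrinfeldKohnoTrunc.mul_eq_left_of_wFil hle u3 y1
  have z13 := DrinfeldKohnoTrunc.mul_eq_zero_of_wFil hlt y1 y3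
  dsimp only [subst₂, t₄]
  unfold dH
  dsimp only [subst₂, t₄]
  rw [hΦ'eq]
  simp only [evalTrunc_add]
  rw [hinv]
  simp only [add_mul, sub_mul, mul_add, mul_sub, r1e1, l2, r1i, z12, r2e2, r1e2, l3, r2u3, z23, r1u3,
    z13, sub_zero, add_zero]
  abel

/-- **Linearization of the second hexagon** (`NCSeries.DrinfeldHexagonB`): the right-hand sides
for `Φ'` and `Φ` differ by `-φ(t₁₂,t₀₂) + φ(t₀₁,t₀₂) - φ(t₀₁,t₁₂)`, `φ = Φ' - Φ` (which is
`-dH_N` of an anti-symmetric `φ`). [cite: BarnatanDancso2011, §3] -/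
theorem hexagonB_rhs_eq_of_agree {Φ Φ' : NCSeries Bool k} (hΦ : Φ [] = 1) (hΦ' : Φ' [] = 1)
    (hagree : ∀ w : List Bool, w.length < N → Φ w = Φ' w) (μ : k) :
    Ring.inverse (subst₂ N Φ' (t₄ k N 1 2) (t₄ k N 0 2)) *
            DrinfeldKohnoTrunc.expT (((1 / 2 : ℚ) • μ) • t₄ k N 0 2) *
          subst₂ N Φ' (t₄ k N 0 1) (t₄ k N 0 2) *
        DrinfeldKohnoTrunc.expT (((1 / 2 : ℚ) • μ) • t₄ k N 0 1) *
      Ring.inverse (subst₂ N Φ' (t₄ k N 0 1) (t₄ k N 1 2)) =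
    Ring.inverse (subst₂ N Φ (t₄ k N 1 2) (t₄ k N 0 2)) *
            DrinfeldKohnoTrunc.expT (((1 / 2 : ℚ) • μ) • t₄ k N 0 2) *
          subst₂ N Φ (t₄ k N 0 1) (t₄ k N 0 2) *
        DrinfeldKohnoTrunc.expT (((1 / 2 : ℚ) • μ) • t₄ k N 0 1) *
      Ring.inverse (subst₂ N Φ (t₄ k N 0 1) (t₄ k N 1 2)) +
    (-subst₂ N (Φ' - Φ) (t₄ k N 1 2) (t₄ k N 0 2) + subst₂ N (Φ' - Φ) (t₄ k N 0 1) (t₄ k N 0 2) -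
      subst₂ N (Φ' - Φ) (t₄ k N 0 1) (t₄ k N 1 2)) := by
  set φ := Φ' - Φ with hφdef
  have hφ : ∀ w : List Bool, w.length < max N 1 → φ w = 0 := fun w hw => by
    rcases Nat.lt_or_ge w.length N with h | h
    · rw [hφdef, sub_apply, hagree w h, sub_self]
    · have h0 : w = [] := List.length_eq_zero_iff.mp (by omega)
      subst h0
      rw [hφdef, sub_apply, hΦ, hΦ', sub_self]
  have hΦ'eq : Φ' = Φ + φ := by rw [hφdef]; abel
  have g1 : ∀ b, bsub (𝔱 1 2) (𝔱 0 2) b ∈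
      (DrinfeldKohnoTrunc.genSpan : Submodule k (DrinfeldKohnoTrunc k (Fin 4) N)) := fun b => by
    cases b
    · exact DrinfeldKohnoTrunc.t_mem_genSpan 1 2
    · exact DrinfeldKohnoTrunc.t_mem_genSpan 0 2
  have g2 : ∀ b, bsub (𝔱 0 1) (𝔱 0 2) b ∈
      (DrinfeldKohnoTrunc.genSpan : Submodule k (DrinfeldKohnoTrunc k (Fin 4) N)) := fun b => by
    cases b
    · exact DrinfeldKohnoTrunc.t_mem_genSpan 0 1
    · exact DrinfeldKohnoTrunc.t_mem_genSpan 0 2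
  have g3 : ∀ b, bsub (𝔱 0 1) (𝔱 1 2) b ∈
      (DrinfeldKohnoTrunc.genSpan : Submodule k (DrinfeldKohnoTrunc k (Fin 4) N)) := fun b => by
    cases b
    · exact DrinfeldKohnoTrunc.t_mem_genSpan 0 1
    · exact DrinfeldKohnoTrunc.t_mem_genSpan 1 2
  have u1 := evalTrunc_sub_one_mem_wFil hΦ _ g1
  have u2 := evalTrunc_sub_one_mem_wFil hΦ _ g2
  have u3 := evalTrunc_sub_one_mem_wFil hΦ _ g3
  have y1 := evalTrunc_mem_wFil hφ _ g1
  have y2 := evalTrunc_mem_wFil hφ _ g2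
  have y3 := evalTrunc_mem_wFil hφ _ g3
  have he1 : DrinfeldKohnoTrunc.expT (((1 / 2 : ℚ) • μ) • 𝔱 0 2) - 1 ∈
      (DrinfeldKohnoTrunc.wFil 1 : Submodule k (DrinfeldKohnoTrunc k (Fin 4) N)) := by
    rw [DrinfeldKohnoTrunc.expT_eq_truncExp]
    exact DrinfeldKohnoTrunc.truncExp_sub_one_mem_wFil
      (Submodule.smul_mem _ _ (DrinfeldKohnoTrunc.t_mem_genSpan 0 2))
  have he2 : DrinfeldKohnoTrunc.expT (((1 / 2 : ℚ) • μ) • 𝔱 0 1) - 1 ∈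
      (DrinfeldKohnoTrunc.wFil 1 : Submodule k (DrinfeldKohnoTrunc k (Fin 4) N)) := by
    rw [DrinfeldKohnoTrunc.expT_eq_truncExp]
    exact DrinfeldKohnoTrunc.truncExp_sub_one_mem_wFil
      (Submodule.smul_mem _ _ (DrinfeldKohnoTrunc.t_mem_genSpan 0 1))
  have hinv1 := (DrinfeldKohnoTrunc.ring_inverse_of_sub_one_mem_wFil u1).2.2
  have hinv3 := (DrinfeldKohnoTrunc.ring_inverse_of_sub_one_mem_wFil u3).2.2
  have hle : N ≤ max N 1 := le_max_left N 1
  have hlt : N < max N 1 + max N 1 := by omega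
  have hi1 : Ring.inverse (evalTrunc N (bsub (𝔱 1 2) (𝔱 0 2)) Φ + evalTrunc N (bsub (𝔱 1 2) (𝔱 0 2)) φ) =
      Ring.inverse (evalTrunc N (bsub (𝔱 1 2) (𝔱 0 2)) Φ) - evalTrunc N (bsub (𝔱 1 2) (𝔱 0 2)) φ :=
    ring_inverse_add_of_wFil hle hlt u1 y1
  have hi3 : Ring.inverse (evalTrunc N (bsub (𝔱 0 1) (𝔱 1 2)) Φ + evalTrunc N (bsub (𝔱 0 1) (𝔱 1 2)) φ) =
      Ring.inverse (evalTrunc N (bsub (𝔱 0 1) (𝔱 1 2)) Φ) - evalTrunc N (bsub (𝔱 0 1) (𝔱 1 2)) φ :=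
    ring_inverse_add_of_wFil hle hlt u3 y3
  -- units along the product: inv₁, inv₁ e₁, inv₁ e₁ U₂, inv₁ e₁ U₂ e₂
  have w1 := DrinfeldKohnoTrunc.mul_sub_one_mem_wFil hinv1 he1
  have w2 := DrinfeldKohnoTrunc.mul_sub_one_mem_wFil w1 u2
  have w3 := DrinfeldKohnoTrunc.mul_sub_one_mem_wFil w2 he2
  -- absorptions and vanishings
  have r1e1 := DrinfeldKohnoTrunc.mul_eq_left_of_wFil hle he1 y1
  have l2 := DrinfeldKohnoTrunc.mul_eq_right_of_wFil hle w1 y2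
  have r1u2 := DrinfeldKohnoTrunc.mul_eq_left_of_wFil hle u2 y1
  have z12 := DrinfeldKohnoTrunc.mul_eq_zero_of_wFil hlt y1 y2
  have r2e2 := DrinfeldKohnoTrunc.mul_eq_left_of_wFil hle he2 y2
  have r1e2 := DrinfeldKohnoTrunc.mul_eq_left_of_wFil hle he2 y1
  have l3 := DrinfeldKohnoTrunc.mul_eq_right_of_wFil hle w3 y3
  have r2i := DrinfeldKohnoTrunc.mul_eq_left_of_wFil hle hinv3 y2
  have z23 := DrinfeldKohnoTrunc.mul_eq_zero_of_wFil hlt y2 y3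
  have r1i := DrinfeldKohnoTrunc.mul_eq_left_of_wFil hle hinv3 y1
  have z13 := DrinfeldKohnoTrunc.mul_eq_zero_of_wFil hlt y1 y3
  dsimp only [subst₂, t₄]
  rw [hΦ'eq]
  simp only [evalTrunc_add]
  rw [hi1, hi3]
  simp only [add_mul, sub_mul, mul_add, mul_sub, r1e1, l2, r1u2, z12, r2e2, r1e2, l3, r2i, z23, r1i,
    z13, sub_zero, add_zero]
  abel

end LinHexagon

end NCSeries

end Literature.NumberTheory.Transcendental
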